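import Literature.NumberTheory.Automorphic.SmoothIndTransport
import Literature.NumberTheory.Automorphic.ParabolicInduction
import Literature.NumberTheory.Automorphic.ParabolicIndGLDetCharIrreducible
import HarnessLib

/-!
# Transport of `Ind_{Q_{N-1,1}}^{GL_N}((ν∘det) ⊠ χ′)` along an isomorphism of local fields

Topic `NumberTheory/Automorphic`; namespace `Literature.NumberTheory.Automorphic.ParabolicIndGLFieldTransport`.  KERNEL ONLY:
theorems; no definition, no named fact, no `sorry`.

For a ring isomorphism `f : K ≃+* K'` of non-archimedean local fields which is a homeomorphism (e.g. the identification
`F_v ≃ E_w` at a split place `w ∣ v` of a quadratic extension, `e(w|v) = f(w|v) = 1`), entrywise application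
`Φ = GL_N(f) : GL_N(K) ≃* GL_N(K')` maps the maximal parabolic `Q_{N-1,1}(K)` onto `Q_{N-1,1}(K')`, commutes with the
Levi projection and the determinant, and preserves the modulus (`Representation.rootDeltaChar_transport`); hence
(`exists_equiv_parabolicIndGL_map`) **the normalised inductions
`parabolicIndGL K (lastBlockLabel N) ((ν∘f) ∘ det ⊠ (χ′∘f))` and `parabolicIndGL K' (lastBlockLabel N) (ν ∘ det ⊠ χ′)`
(`Zelevinsky1980.maxParabolicLeviChar`) are isomorphic along `Φ`** (tree `SmoothInd.transportEquiv`).  Generic plumbing for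
the split-place model [Liu2021, App. D, proof of Lem. D.1, p. 126] (`E_w = F_v` «through the first factor»).  HC_CM is not
mentioned further.
-/

set_option autoImplicit false

noncomputable section

open scoped MatrixGroups
open Literature.NumberTheory.Automorphic.Zelevinsky1980 (lastBlockLabel maxParabolicLeviChar)

namespace Literature.NumberTheory.Automorphic.ParabolicIndGLFieldTransport

variable {K K' : Type*} [Field K] [ValuativeRel K] [TopologicalSpace K] [IsNonarchimedeanLocalField K]
  [Field K'] [ValuativeRel K'] [TopologicalSpace K'] [IsNonarchimedeanLocalField K']
  (f : K ≃+* K') (hf : Continuous f) (hf' : Continuous f.symm) {N : ℕ}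

omit [ValuativeRel K] [TopologicalSpace K] [IsNonarchimedeanLocalField K] [ValuativeRel K'] [TopologicalSpace K']
  [IsNonarchimedeanLocalField K'] in
/-- `GL_N(f) : GL_N(K) ≃* GL_N(K')` for a ring isomorphism `f` (entrywise), with inverse `GL_N(f⁻¹)`.
[cite: BernsteinZelevinsky1976, §2.21–2.25] -/
theorem exists_mulEquiv_map :
    ∃ Φ : GL (Fin N) K ≃* GL (Fin N) K', (∀ g, Φ g = Matrix.GeneralLinearGroup.map (f : K →+* K') g) ∧
      (∀ g, Φ.symm g = Matrix.GeneralLinearGroup.map (f.symm : K' →+* K) g) := by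
  have hl : ∀ g : GL (Fin N) K, Matrix.GeneralLinearGroup.map (f.symm : K' →+* K)
      (Matrix.GeneralLinearGroup.map (f : K →+* K') g) = g := fun g =>
    Units.ext (Matrix.ext fun i j => f.symm_apply_apply _)
  have hr : ∀ g : GL (Fin N) K', Matrix.GeneralLinearGroup.map (f : K →+* K')
      (Matrix.GeneralLinearGroup.map (f.symm : K' →+* K) g) = g := fun g =>
    Units.ext (Matrix.ext fun i j => f.apply_symm_apply _)
  exact ⟨MonoidHom.toMulEquiv (Matrix.GeneralLinearGroup.map (f : K →+* K'))
    (Matrix.GeneralLinearGroup.map (f.symm : K' →+* K)) (MonoidHom.ext hl) (MonoidHom.ext hr), fun _ => rfl, fun _ => rfl⟩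

include hf hf' in
/-- **Transport of `Ind_{Q_{N-1,1}}^{GL_N}((ν ∘ det) ⊠ χ′)` along `GL_N(f)`**: for `f : K ≃+* K'` a homeomorphic field
isomorphism and characters `ν, χ′` of `K'ˣ`, there are `Φ = GL_N(f)` and a linear isomorphism `Ψ` between the induced spaces
with `Ψ (Ind_K(g) φ) = Ind_{K'}(Φ g) (Ψ φ)`, where the `K`-side characters are `ν ∘ f`, `χ′ ∘ f` (`Units.map f`).
[cite: BernsteinZelevinsky1976, §2.21–2.25] -/
theorem exists_equiv_parabolicIndGL_map (ν χ' : K'ˣ →* ℂˣ) :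
    ∃ (Φ : GL (Fin N) K ≃* GL (Fin N) K') (Ψ :
      Representation.SmoothInd (standardParabolicGL K (lastBlockLabel N))
        (Representation.twist (((Representation.trivial ℂ (Π a : Bool, GL {i : Fin N // lastBlockLabel N i = a} K) ℂ).twist
          (maxParabolicLeviChar K N (ν.comp (Units.map (f : K →+* K').toMonoidHom))
            (χ'.comp (Units.map (f : K →+* K').toMonoidHom)))).comp (leviProjection K (lastBlockLabel N)))
          (rootDeltaChar (standardParabolicGL K (lastBlockLabel N)))) ≃ₗ[ℂ]
      Representation.SmoothInd (standardParabolicGL K' (lastBlockLabel N))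
        (Representation.twist (((Representation.trivial ℂ (Π a : Bool, GL {i : Fin N // lastBlockLabel N i = a} K') ℂ).twist
          (maxParabolicLeviChar K' N ν χ')).comp (leviProjection K' (lastBlockLabel N)))
          (rootDeltaChar (standardParabolicGL K' (lastBlockLabel N))))),
      (∀ g, Φ g = Matrix.GeneralLinearGroup.map (f : K →+* K') g) ∧
      ∀ g φ, Ψ (Representation.parabolicIndGL K (lastBlockLabel N)
          ((Representation.trivial ℂ (Π a : Bool, GL {i : Fin N // lastBlockLabel N i = a} K) ℂ).twist
            (maxParabolicLeviChar K N (ν.comp (Units.map (f : K →+* K').toMonoidHom))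
              (χ'.comp (Units.map (f : K →+* K').toMonoidHom)))) g φ) =
        Representation.parabolicIndGL K' (lastBlockLabel N)
          ((Representation.trivial ℂ (Π a : Bool, GL {i : Fin N // lastBlockLabel N i = a} K') ℂ).twist
            (maxParabolicLeviChar K' N ν χ')) (Φ g) (Ψ φ) := by
  obtain ⟨Φ, hΦ, hΦ'⟩ := exists_mulEquiv_map f (N := N)
  have hΦc : Continuous Φ := by
    have : (Φ : GL (Fin N) K → GL (Fin N) K') = fun g => Matrix.GeneralLinearGroup.map (f : K →+* K') g := funext hΦ
    rw [this]; exact Continuous.units_map _ (continuous_id.matrix_map hf)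
  have hΦc' : Continuous Φ.symm := by
    have : (Φ.symm : GL (Fin N) K' → GL (Fin N) K) = fun g => Matrix.GeneralLinearGroup.map (f.symm : K' →+* K) g :=
      funext hΦ'
    rw [this]; exact Continuous.units_map _ (continuous_id.matrix_map hf')
  -- `Φ` maps `Q(K)` onto `Q(K')`
  have hH : ∀ x, Φ x ∈ standardParabolicGL K' (lastBlockLabel N) ↔ x ∈ standardParabolicGL K (lastBlockLabel N) := by
    intro x
    rw [mem_standardParabolicGL_iff, mem_standardParabolicGL_iff, hΦ]
    change (((x : GL (Fin N) K) : Matrix (Fin N) (Fin N) K).map (f : K →+* K')).BlockTriangular (lastBlockLabel N) ↔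
      ((x : GL (Fin N) K) : Matrix (Fin N) (Fin N) K).BlockTriangular (lastBlockLabel N)
    constructor
    · intro h
      have h' := h.map (f.symm : K' →+* K)
      have : (((x : GL (Fin N) K) : Matrix (Fin N) (Fin N) K).map (f : K →+* K')).map (f.symm : K' →+* K) =
          ((x : GL (Fin N) K) : Matrix (Fin N) (Fin N) K) := Matrix.ext fun i j => f.symm_apply_apply _
      rwa [this] at h'
    · exact fun h => h.map (f : K →+* K')
  -- the determinants of the Levi blocks are transported by `f`
  have hdet : ∀ (x : standardParabolicGL K (lastBlockLabel N)) (a : Bool),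
      Matrix.GeneralLinearGroup.det (leviProjection K' (lastBlockLabel N) ⟨Φ x, (hH x).2 x.2⟩ a) =
        Units.map (f : K →+* K').toMonoidHom (Matrix.GeneralLinearGroup.det (leviProjection K (lastBlockLabel N) x a)) := by
    intro x a
    apply Units.ext
    rw [Matrix.GeneralLinearGroup.val_det_apply, Units.coe_map, RingHom.toMonoidHom_eq_coe, MonoidHom.coe_coe,
      Matrix.GeneralLinearGroup.val_det_apply, coe_leviProjection_apply, coe_leviProjection_apply, RingHom.map_det]
    congr 1
    ext i j
    simp only [Matrix.toSquareBlock_def, Matrix.of_apply, RingHom.mapMatrix_apply, Matrix.map_apply, hΦ,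
      Matrix.GeneralLinearGroup.map_apply]
  -- the inducing characters agree along `Φ`
  have hσ : ∀ x : standardParabolicGL K (lastBlockLabel N),
      (Representation.twist (((Representation.trivial ℂ (Π a : Bool, GL {i : Fin N // lastBlockLabel N i = a} K) ℂ).twist
          (maxParabolicLeviChar K N (ν.comp (Units.map (f : K →+* K').toMonoidHom))
            (χ'.comp (Units.map (f : K →+* K').toMonoidHom)))).comp (leviProjection K (lastBlockLabel N)))
          (rootDeltaChar (standardParabolicGL K (lastBlockLabel N)))) x =
      (Representation.twist (((Representation.trivial ℂ (Π a : Bool, GL {i : Fin N // lastBlockLabel N i = a} K') ℂ).twist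
          (maxParabolicLeviChar K' N ν χ')).comp (leviProjection K' (lastBlockLabel N)))
          (rootDeltaChar (standardParabolicGL K' (lastBlockLabel N)))) ⟨Φ x, (hH x).2 x.2⟩ := by
    intro x
    apply LinearMap.ext
    intro z
    change ((rootDeltaChar (standardParabolicGL K (lastBlockLabel N)) x : ℂˣ) : ℂ) *
        (((maxParabolicLeviChar K N (ν.comp (Units.map (f : K →+* K').toMonoidHom)) (χ'.comp (Units.map (f : K →+* K').toMonoidHom)) (leviProjection K (lastBlockLabel N) x) : ℂˣ) : ℂ) * z) =
      ((rootDeltaChar (standardParabolicGL K' (lastBlockLabel N)) ⟨Φ x, (hH x).2 x.2⟩ : ℂˣ) : ℂ) *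
        (((maxParabolicLeviChar K' N ν χ' (leviProjection K' (lastBlockLabel N) ⟨Φ x, (hH x).2 x.2⟩) : ℂˣ) : ℂ) * z)
    rw [Representation.rootDeltaChar_transport Φ hΦc hΦc' hH x, Zelevinsky1980.maxParabolicLeviChar_apply,
      Zelevinsky1980.maxParabolicLeviChar_apply, MonoidHom.comp_apply, MonoidHom.comp_apply, hdet, hdet]
  refine ⟨Φ, Representation.SmoothInd.transportEquiv Φ hΦc hΦc' hH hσ, hΦ, fun g φ => ?_⟩
  exact Representation.SmoothInd.transportEquiv_smoothIndRep Φ hΦc hΦc' hH hσ g φ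

end Literature.NumberTheory.Automorphic.ParabolicIndGLFieldTransport

end
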